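import Literature.Analysis.FunctionSpaces.TorusShearKoopman
import Summits.AnomalousDissipation.AnomalousDissipation.Theorems.SawtoothPulseCascadeK1LocalisedCascadeSmoothLeakage

/-!
# K1loc, line `Spectral` / SeqCone — helper: SPECTRAL LEAKAGE OF THE SHEAR KOOPMAN OPERATOR ON ONE FIBRE

Helper file of the first prover lane on the crux `K1LocalisedCascade` (stmt-AnomalousDissipation-19491), route
`SawtoothPulseCascade`.  It connects this lane's leakage lemmas (`…SpectralLeakage`, `…SmoothLeakage`) with the tree's shear
Koopman calculus `Literature/Analysis/FunctionSpaces/TorusShearKoopman` (transversal shear `Φ(x) = x − φ(x_j)eᵢ`,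
`Torus.shearMap`; phase function `g_n = Torus.twist P n`; `Torus.comp_shearMap_of_fibre`: a function supported on the fibre
`{k : k_i = n}` satisfies `θ ∘ Φ = g_n(x_j) · θ`).  Each inviscid half-pulse of the cascade is such a shear (H pulse of phase
`j`: `i = 0`, `j = 1`, `φ = −γ U_j`), so on every fibre the inviscid transport is MULTIPLICATION BY A UNIMODULAR MULTIPLIER
(`Torus.norm_twist`), and the smooth-symbol leakage lemma applies verbatim:

* `comp_shearMap_eq_mul_of_fibre` — the functional form of `comp_shearMap_of_fibre`;
* `sqrt_tsum_symbol_sq_comp_shearMap_fibre_le` — **Koopman leakage on one fibre**: for `θ` smooth with all modes on the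
  fibre `k_i = n`, a bounded real symbol `m` with modulus `ω`, and the multiplier `Θ(x) = g_n(x_j)` with spectral data
  `∑_q ω q ‖𝓕Θ q‖ < ∞`:  `‖m(D)(θ ∘ Φ)‖ ≤ ‖m(D)θ‖ + (∑_q ω q ‖𝓕Θ q‖) · ‖θ‖_{L²}`
  (`𝓕Θ` lives on the `eⱼ` axis, `Torus.mFourierCoeff_comp_eval`, so the moment is that of the circle coefficients of `g_n`).

* `tsum_symbol_sq_sum_eq_of_fibre` (weighted Parseval across fibres), `sqrt_sum_add_sq_le` (finite Minkowski) and
  `sqrt_tsum_symbol_sq_comp_shearMap_le_of_band` — **Koopman leakage for band-limited functions**: for `θ` smooth with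
  finitely many `i`-fibres and a uniform moment bound `A` for the fibre multipliers `g_n(x_j)`,
  `‖m(D)(θ ∘ Φ)‖ ≤ ‖m(D)θ‖ + A‖θ‖` — the inviscid Egorov step for a general transversal shear (`i ≠ j`).

The ± strip localisers of the rounded sawtooth (`…SpectralCommutator`, `…FlatSlope`), which make the moment bound uniform in
the fibre index, are the line's next step.  WHAT THIS IS NOT: no statement about
the cascade scalar.  [cite: Grafakos2014, Prop. 3.1.2 (5) and Prop. 3.2.7 (3)] [problem: turb]
-/

-- `Summit.<Summit>.<Problem>`: single-conjunct summit, the duplicate namespace segment is deliberate.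
set_option linter.dupNamespace false

noncomputable section

namespace Summit.AnomalousDissipation.AnomalousDissipation.Theorems.SawtoothPulseCascade.SpectralLeakage

open MeasureTheory Set Filter Topology UnitAddTorus Complex
open Literature.Analysis Literature.Analysis.FunctionSpaces Literature.Analysis.FluidPDE
open Literature.Analysis.FunctionSpaces.Torus

variable {d : Type*} [Fintype d] [DecidableEq d]

/-- Functional form of the tree's `comp_shearMap_of_fibre`: a smooth function supported on the fibre `k_i = n` is
transported by the shear `Φ(x) = x − φ(x_j)eᵢ` as `θ ∘ Φ = (g_n ∘ x_j) · θ`. [folklore] -/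
theorem comp_shearMap_eq_mul_of_fibre {θ : UnitAddTorus d → ℂ} {i : d} (hθ : IsSmooth θ) {n : ℤ}
    (hn : ∀ k, mFourierCoeff θ k ≠ 0 → k i = n) (P : ShearProfile) (j : d) :
    θ ∘ shearMap i j P = fun x => twist P n (x j) * θ x :=
  funext fun x => comp_shearMap_of_fibre hθ hn P j x

/-- **Koopman leakage on one fibre.**  Let `θ : T^d → ℂ` be smooth with all its modes on the fibre `k_i = n`, let
`Φ(x) = x − φ(x_j)eᵢ` be a transversal shear (`Torus.shearMap i j P`) with phase function `g_n = Torus.twist P n`, and let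
`m` be a real symbol with `|m| ≤ M` and modulus `ω ≥ 0` (`|m k − m (k−q)| ≤ ω q`).  If the multiplier `Θ(x) = g_n(x_j)` has
summable coefficients and `∑_q ω q ‖𝓕Θ q‖ < ∞`, then
`√(∑ₖ m_k² ‖𝓕(θ ∘ Φ) k‖²) ≤ √(∑ₖ m_k² ‖𝓕θ k‖²) + (∑_q ω q ‖𝓕Θ q‖) · √(∫‖θ‖²)`.
[cite: Grafakos2014, Prop. 3.1.2 (5) (coefficients of products) and Prop. 3.2.7 (3) (Parseval)] -/
theorem sqrt_tsum_symbol_sq_comp_shearMap_fibre_le {θ : UnitAddTorus d → ℂ} {i : d} (hθ : IsSmooth θ) {n : ℤ}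
    (hn : ∀ k, mFourierCoeff θ k ≠ 0 → k i = n) (P : ShearProfile) (j : d)
    {m : (d → ℤ) → ℝ} {M : ℝ} (hmM : ∀ k, |m k| ≤ M) {ω : (d → ℤ) → ℝ} (hω0 : ∀ q, 0 ≤ ω q)
    (hω : ∀ k q, |m k - m (k - q)| ≤ ω q)
    (hΘs : Summable fun q => ‖mFourierCoeff (fun x : UnitAddTorus d => twist P n (x j)) q‖)
    (hωs : Summable fun q => ω q * ‖mFourierCoeff (fun x : UnitAddTorus d => twist P n (x j)) q‖) :
    Real.sqrt (∑' k, m k ^ 2 * ‖mFourierCoeff (θ ∘ shearMap i j P) k‖ ^ 2) ≤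
      Real.sqrt (∑' k, m k ^ 2 * ‖mFourierCoeff θ k‖ ^ 2) +
        (∑' q, ω q * ‖mFourierCoeff (fun x : UnitAddTorus d => twist P n (x j)) q‖) *
          Real.sqrt (∫ x, ‖θ x‖ ^ 2) := by
  rw [comp_shearMap_eq_mul_of_fibre hθ hn P j]
  have hΘc : Continuous fun x : UnitAddTorus d => twist P n (x j) :=
    (continuous_twist P n).comp (continuous_apply j)
  exact sqrt_tsum_symbol_sq_mul_le hθ.continuous hθ.rapidDecay_mFourierCoeff.summable_norm hΘc hΘs
    (fun x => (norm_twist P n (x j)).le) hmM hω0 hω hωs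

/-! ## §2 Assembly over finitely many fibres (band-limited functions) -/

omit [DecidableEq d] in
/-- **Weighted Parseval across fibres**: for smooth `f_n` supported on distinct fibres `{k : k_i = n}` and a bounded real symbol
`m`, `∑ₖ m_k² ‖𝓕(∑_{n∈s} f_n)(k)‖² = ∑_{n∈s} ∑ₖ m_k² ‖𝓕f_n(k)‖²` (at most one fibre contributes to each mode). [folklore] -/
theorem tsum_symbol_sq_sum_eq_of_fibre (i : d) (s : Finset ℤ) {f : ℤ → UnitAddTorus d → ℂ}
    (hf : ∀ n ∈ s, IsSmooth (f n)) (hsupp : ∀ n ∈ s, ∀ k, mFourierCoeff (f n) k ≠ 0 → k i = n)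
    {m : (d → ℤ) → ℝ} {M : ℝ} (hmM : ∀ k, |m k| ≤ M) :
    (∀ n ∈ s, Summable fun k => m k ^ 2 * ‖mFourierCoeff (f n) k‖ ^ 2) ∧
    ∑' k, m k ^ 2 * ‖mFourierCoeff (fun x => ∑ n ∈ s, f n x) k‖ ^ 2 =
      ∑ n ∈ s, ∑' k, m k ^ 2 * ‖mFourierCoeff (f n) k‖ ^ 2 := by
  have hM0 : 0 ≤ M := (abs_nonneg _).trans (hmM 0)
  have hm2 : ∀ k, m k ^ 2 ≤ M ^ 2 := fun k => by
    rw [← sq_abs]; exact pow_le_pow_left₀ (abs_nonneg _) (hmM k) 2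
  -- summability of each weighted family (bounded symbol × Parseval)
  have hsum : ∀ n ∈ s, Summable fun k => m k ^ 2 * ‖mFourierCoeff (f n) k‖ ^ 2 := fun n hn =>
    ((hasSum_sq_mFourierCoeff_of_continuous (hf n hn).continuous).summable.mul_left (M ^ 2)).of_nonneg_of_le
      (fun k => by positivity) fun k => mul_le_mul_of_nonneg_right (hm2 k) (sq_nonneg _)
  refine ⟨hsum, ?_⟩
  have hcoeff : ∀ k, mFourierCoeff (fun x => ∑ n ∈ s, f n x) k = ∑ n ∈ s, mFourierCoeff (f n) k :=
    mFourierCoeff_finset_sum s fun n hn => (hf n hn).integrable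
  -- at most one fibre contributes to each mode
  have hpt : ∀ k, ‖mFourierCoeff (fun x => ∑ n ∈ s, f n x) k‖ ^ 2 = ∑ n ∈ s, ‖mFourierCoeff (f n) k‖ ^ 2 := by
    intro k
    rw [hcoeff]
    by_cases hk : k i ∈ s
    · rw [Finset.sum_eq_single (k i), Finset.sum_eq_single (k i)]
      · intro n hn hne
        rw [show mFourierCoeff (f n) k = 0 from not_not.1 fun h => hne (hsupp n hn k h).symm]
        simp
      · exact fun h => absurd hk h
      · intro n hn hne
        exact not_not.1 fun h => hne (hsupp n hn k h).symm
      · exact fun h => absurd hk h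
    · have h0 : ∀ n ∈ s, mFourierCoeff (f n) k = 0 := fun n hn =>
        not_not.1 fun h => hk ((hsupp n hn k h) ▸ hn)
      rw [Finset.sum_eq_zero h0, Finset.sum_eq_zero (fun n hn => by rw [h0 n hn]; simp)]
      simp
  simp_rw [hpt, Finset.mul_sum]
  exact Summable.tsum_finsetSum fun n hn => hsum n hn

omit [Fintype d] [DecidableEq d] in
/-- Minkowski for finite sums in `√`-form: `√(∑(a+b)²) ≤ √(∑a²) + √(∑b²)` for nonnegative families. [folklore] -/
theorem sqrt_sum_add_sq_le {ι : Type*} (s : Finset ι) {a b : ι → ℝ} (ha : ∀ n ∈ s, 0 ≤ a n) (hb : ∀ n ∈ s, 0 ≤ b n) :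
    Real.sqrt (∑ n ∈ s, (a n + b n) ^ 2) ≤ Real.sqrt (∑ n ∈ s, a n ^ 2) + Real.sqrt (∑ n ∈ s, b n ^ 2) := by
  set A := Real.sqrt (∑ n ∈ s, a n ^ 2) with hA
  set B := Real.sqrt (∑ n ∈ s, b n ^ 2) with hB
  have hA0 : 0 ≤ A := Real.sqrt_nonneg _
  have hB0 : 0 ≤ B := Real.sqrt_nonneg _
  have hA2 : A ^ 2 = ∑ n ∈ s, a n ^ 2 := Real.sq_sqrt (Finset.sum_nonneg fun n _ => sq_nonneg _)
  have hB2 : B ^ 2 = ∑ n ∈ s, b n ^ 2 := Real.sq_sqrt (Finset.sum_nonneg fun n _ => sq_nonneg _)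
  have hCS : (∑ n ∈ s, a n * b n) ^ 2 ≤ (∑ n ∈ s, a n ^ 2) * ∑ n ∈ s, b n ^ 2 :=
    Finset.sum_sq_le_sum_mul_sum_of_sq_le_mul s (fun n _ => sq_nonneg (a n)) (fun n _ => sq_nonneg (b n))
      fun n _ => le_of_eq (by ring)
  have hab : ∑ n ∈ s, a n * b n ≤ A * B := by
    have h0 : 0 ≤ ∑ n ∈ s, a n * b n := Finset.sum_nonneg fun n hn => mul_nonneg (ha n hn) (hb n hn)
    rw [← hA2, ← hB2, ← mul_pow] at hCS
    exact (pow_le_pow_iff_left₀ h0 (mul_nonneg hA0 hB0) two_ne_zero).mp hCS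
  have hsum : ∑ n ∈ s, (a n + b n) ^ 2 = ∑ n ∈ s, a n ^ 2 + 2 * ∑ n ∈ s, a n * b n + ∑ n ∈ s, b n ^ 2 := by
    rw [Finset.mul_sum, ← Finset.sum_add_distrib, ← Finset.sum_add_distrib]
    exact Finset.sum_congr rfl fun n _ => by ring
  have hle : ∑ n ∈ s, (a n + b n) ^ 2 ≤ (A + B) ^ 2 := by
    rw [hsum, ← hA2, ← hB2]; nlinarith
  calc Real.sqrt (∑ n ∈ s, (a n + b n) ^ 2) ≤ Real.sqrt ((A + B) ^ 2) := Real.sqrt_le_sqrt hle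
    _ = A + B := Real.sqrt_sq (add_nonneg hA0 hB0)

/-- **Koopman leakage for band-limited functions** (finitely many fibres).  Let `θ : T^d → ℂ` be smooth with its `i`-th
frequencies in a finite set `s` (`𝓕θ k ≠ 0 → k_i ∈ s`), `Φ = shearMap i j P` a transversal shear (`i ≠ j`), `m` a real symbol
with `|m| ≤ M` and modulus `ω`, and suppose every fibre multiplier `Θ_n(x) = g_n(x_j)`, `n ∈ s`, has summable coefficients
with `∑_q ω q ‖𝓕Θ_n q‖ ≤ A`.  Then  `‖m(D)(θ ∘ Φ)‖ ≤ ‖m(D)θ‖ + A ‖θ‖`: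
`√(∑ₖ m_k²‖𝓕(θ∘Φ) k‖²) ≤ √(∑ₖ m_k²‖𝓕θ k‖²) + A √(∫‖θ‖²)`
(fibre decomposition `Torus.eq_sum_modePiece`, the one-fibre lemma, the weighted Parseval across fibres, and finite
Minkowski).  TODO(general form): smooth `θ` without band limitation, by truncation.
[cite: Grafakos2014, Prop. 3.1.2 (5) and Prop. 3.2.7 (3)] -/
theorem sqrt_tsum_symbol_sq_comp_shearMap_le_of_band {θ : UnitAddTorus d → ℂ} {i j : d} (hθ : IsSmooth θ) (hij : i ≠ j)
    (s : Finset ℤ) (hband : ∀ k, mFourierCoeff θ k ≠ 0 → k i ∈ s) (P : ShearProfile)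
    {m : (d → ℤ) → ℝ} {M : ℝ} (hmM : ∀ k, |m k| ≤ M) {ω : (d → ℤ) → ℝ} (hω0 : ∀ q, 0 ≤ ω q)
    (hω : ∀ k q, |m k - m (k - q)| ≤ ω q)
    (hΘs : ∀ n ∈ s, Summable fun q => ‖mFourierCoeff (fun x : UnitAddTorus d => twist P n (x j)) q‖)
    (hωs : ∀ n ∈ s, Summable fun q => ω q * ‖mFourierCoeff (fun x : UnitAddTorus d => twist P n (x j)) q‖)
    {A : ℝ} (hA0 : 0 ≤ A)
    (hA : ∀ n ∈ s, ∑' q, ω q * ‖mFourierCoeff (fun x : UnitAddTorus d => twist P n (x j)) q‖ ≤ A) :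
    Real.sqrt (∑' k, m k ^ 2 * ‖mFourierCoeff (θ ∘ shearMap i j P) k‖ ^ 2) ≤
      Real.sqrt (∑' k, m k ^ 2 * ‖mFourierCoeff θ k‖ ^ 2) + A * Real.sqrt (∫ x, ‖θ x‖ ^ 2) := by
  classical
  -- fibre pieces
  set θn : ℤ → UnitAddTorus d → ℂ := fun n => modePiece (fibre i n) θ with hθn_def
  have hθn_smooth : ∀ n, IsSmooth (θn n) := fun n => isSmooth_modePiece hθ _
  have hθn_supp : ∀ n, ∀ k, mFourierCoeff (θn n) k ≠ 0 → k i = n := by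
    intro n k hk
    rw [hθn_def, mFourierCoeff_modePiece hθ] at hk
    by_contra h
    exact hk (Set.indicator_of_notMem (show k ∉ fibre i n from h) _)
  have hθsum : θ = ∑ n ∈ s, θn n :=
    eq_sum_modePiece hθ s (fibre i) (pairwiseDisjoint_fibre i _) fun k hk => ⟨k i, hband k hk, rfl⟩
  have hθfun : θ = fun x => ∑ n ∈ s, θn n x := by
    rw [hθsum]; funext x; exact Finset.sum_apply x s θn
  -- transported pieces
  set ψn : ℤ → UnitAddTorus d → ℂ := fun n => θn n ∘ shearMap i j P with hψn_def
  have hψn_smooth : ∀ n, IsSmooth (ψn n) := fun n => (hθn_smooth n).comp_shearMap i j P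
  have hψn_supp : ∀ n, ∀ k, mFourierCoeff (ψn n) k ≠ 0 → k i = n := by
    intro n k hk
    by_contra h
    exact hk (mFourierCoeff_comp_shearMap_eq_zero_of_apply_not_mem (hθn_smooth n).continuous
      (hθn_smooth n).rapidDecay_mFourierCoeff.summable_norm hij P (A := {n})
      (fun k' hk' => not_not.1 fun h' => hk' (hθn_supp n k' h')) h)
  have hcomp : θ ∘ shearMap i j P = fun x => ∑ n ∈ s, ψn n x := by
    funext x
    simp only [Function.comp_apply, hψn_def]
    rw [hθfun]
  -- fibrewise weighted Parseval on both sides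
  obtain ⟨hsumψ, hψeq⟩ := tsum_symbol_sq_sum_eq_of_fibre i s (f := ψn) (fun n _ => hψn_smooth n)
    (fun n _ => hψn_supp n) hmM
  obtain ⟨hsumθ, hθeq⟩ := tsum_symbol_sq_sum_eq_of_fibre i s (f := θn) (fun n _ => hθn_smooth n)
    (fun n _ => hθn_supp n) hmM
  have hθeq' : ∑' k, m k ^ 2 * ‖mFourierCoeff θ k‖ ^ 2 = ∑ n ∈ s, ∑' k, m k ^ 2 * ‖mFourierCoeff (θn n) k‖ ^ 2 := by
    rw [← hθeq, ← hθfun]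
  -- per-fibre estimate
  set a : ℤ → ℝ := fun n => Real.sqrt (∑' k, m k ^ 2 * ‖mFourierCoeff (θn n) k‖ ^ 2) with ha_def
  set b : ℤ → ℝ := fun n => A * Real.sqrt (∫ x, ‖θn n x‖ ^ 2) with hb_def
  have hfib : ∀ n ∈ s, ∑' k, m k ^ 2 * ‖mFourierCoeff (ψn n) k‖ ^ 2 ≤ (a n + b n) ^ 2 := by
    intro n hn
    have h1 := sqrt_tsum_symbol_sq_comp_shearMap_fibre_le (hθn_smooth n) (hθn_supp n) P j hmM hω0 hω
      (hΘs n hn) (hωs n hn)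
    have h2 : Real.sqrt (∑' k, m k ^ 2 * ‖mFourierCoeff (θn n ∘ shearMap i j P) k‖ ^ 2) ≤ a n + b n :=
      h1.trans (add_le_add le_rfl (mul_le_mul_of_nonneg_right (hA n hn) (Real.sqrt_nonneg _)))
    have h0 : 0 ≤ ∑' k, m k ^ 2 * ‖mFourierCoeff (ψn n) k‖ ^ 2 := tsum_nonneg fun k => by positivity
    have hab0 : 0 ≤ a n + b n := add_nonneg (Real.sqrt_nonneg _) (mul_nonneg hA0 (Real.sqrt_nonneg _))
    calc ∑' k, m k ^ 2 * ‖mFourierCoeff (ψn n) k‖ ^ 2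
        = (Real.sqrt (∑' k, m k ^ 2 * ‖mFourierCoeff (ψn n) k‖ ^ 2)) ^ 2 := (Real.sq_sqrt h0).symm
      _ ≤ (a n + b n) ^ 2 := pow_le_pow_left₀ (Real.sqrt_nonneg _) h2 2
  -- Parseval across fibres for the `L²` norms
  have hL2 : ∑ n ∈ s, ∫ x, ‖θn n x‖ ^ 2 = ∫ x, ‖θ x‖ ^ 2 := by
    rw [← integral_norm_sq_sum_eq_of_fibre i s (fun n _ => hθn_smooth n) (fun n _ => hθn_supp n)]
    have hint : (fun x => ‖θ x‖ ^ 2) = fun x => ‖∑ n ∈ s, θn n x‖ ^ 2 := by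
      funext x; rw [hθfun]
    rw [hint]
  -- assemble
  have hb_sq : ∑ n ∈ s, b n ^ 2 = A ^ 2 * ∫ x, ‖θ x‖ ^ 2 := by
    rw [← hL2, Finset.mul_sum]
    refine Finset.sum_congr rfl fun n _ => ?_
    rw [hb_def, mul_pow, Real.sq_sqrt (integral_nonneg fun x => by positivity)]
  have ha_sq : ∑ n ∈ s, a n ^ 2 = ∑' k, m k ^ 2 * ‖mFourierCoeff θ k‖ ^ 2 := by
    rw [hθeq']
    refine Finset.sum_congr rfl fun n _ => ?_
    rw [ha_def, Real.sq_sqrt (tsum_nonneg fun k => by positivity)]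
  calc Real.sqrt (∑' k, m k ^ 2 * ‖mFourierCoeff (θ ∘ shearMap i j P) k‖ ^ 2)
      = Real.sqrt (∑ n ∈ s, ∑' k, m k ^ 2 * ‖mFourierCoeff (ψn n) k‖ ^ 2) := by rw [hcomp, hψeq]
    _ ≤ Real.sqrt (∑ n ∈ s, (a n + b n) ^ 2) := Real.sqrt_le_sqrt (Finset.sum_le_sum hfib)
    _ ≤ Real.sqrt (∑ n ∈ s, a n ^ 2) + Real.sqrt (∑ n ∈ s, b n ^ 2) :=
        sqrt_sum_add_sq_le s (fun n _ => Real.sqrt_nonneg _) (fun n _ => mul_nonneg hA0 (Real.sqrt_nonneg _))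
    _ = Real.sqrt (∑' k, m k ^ 2 * ‖mFourierCoeff θ k‖ ^ 2) + A * Real.sqrt (∫ x, ‖θ x‖ ^ 2) := by
        rw [ha_sq, hb_sq, Real.sqrt_mul' _ (integral_nonneg fun x => by positivity), Real.sqrt_sq hA0]

end Summit.AnomalousDissipation.AnomalousDissipation.Theorems.SawtoothPulseCascade.SpectralLeakage
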